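import Literature.NumberTheory.Automorphic.FiniteAdelePureTensorIntegral
import Literature.NumberTheory.Automorphic.UnitaryGroupRestrictedProduct
import Summits.HodgeConjecture.HodgeCM.PerL34.PureTensorChar_1
import HarnessLib

/-!
# H413 ∕ S4′(ii) (FIN), step (F2): the finite Fourier-coefficient integrand of a pair of pure tensors is a
# pure tensor over the places

Crux H413, line `F0_P4AdmissibleOccursInH1`, stub S4b (`θ_t ≠ 0`), [Li1992, (27)] at the finite places.  The consumer
is ★ `exists_integral_finAdelic_eq_tprod` (`H413FinAdelicEulerFactorisation`, the Euler exchange over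
`U(J)(𝔸_{F,f}) = Πʳ_v [U(J)(F_v), U(J)(𝒪_v)]`), whose binder is the PURE-TENSOR hypothesis in the glue currency of the
HodgeCM∕PerL34 engine: on every principal level `S ⊇ T`,
`f(e⁻¹(glue_S(x, k))) = ∏_{v ∈ S} f_v(x_v)`.  This file proves that binder for the integrand of S4b,

  `f(b) = (∫ (ω_f(b) Φ_f)(y) conj(Ψ_f(y)) dμ(y)) · w(b)`,   `Φ_f = ⊗_v Φ_v`, `Ψ_f = ⊗_v Ψ_v` pure tensors,

from three inputs, each a theorem of the tree or a displayed hypothesis: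
* (i) `hω` — `ω_f` ACTS PLACEWISE ON PURE TENSORS: `ω_f(b)(⊗_v Φ_v) = ⊗_v ρ_v((E b)_v) Φ_v` for local representations
  `ρ_v` of groups `G_v ⊇ K_v` on `𝒮(F_vⁿ)` and a «components» map `E : U(J)(𝔸_{F,f}) → Πʳ_v [G_v, K_v]` whose `v`-component
  depends only on the `v`-component `evalPlace v b` (`hE`, through local maps `E_v`) and sends `U(J)(𝒪_v)` into `K_v` off
  `T` (`hEint`), with `1_{𝒪_vⁿ}` `K_v`-fixed off `T` (`hρT`) — at the cell's pin this is ★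
  `WeilCoinv.finPairRep_chiSplittingLine_symm_piProdSB` (`FinLocalSplittings.Omega_piProdSB`) for the pair embedding
  `b ↦ 1 ⊗ b` and `ρ_v = 𝓢_χ.omegaLoc v`;
* (ii) `w : U(J)(𝔸_{F,f}) →* ℂ` multiplicative and trivial on the box subgroup `∏_{v ∉ T} U(J)(𝒪_v) × ∏_{v ∈ T} {1}`
  (for a continuous unitary character this holds for some `T`: ★ `PureTensor.exists_boxSubgroup_le_ker`);
* (iii) ★ `integral_piProd_mul_conj_piProd_eq` (`FiniteAdelePureTensorIntegral`): the `L²(μ)`-pairing of two pure tensors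
  is `μ(𝒪̂ⁿ) • ∏_v ν_v(𝒪_vⁿ)⁻¹ ⟨Φ_v, Ψ_v⟩_{ν_v}`.

Main results (namespace `Summit.HodgeConjecture.HodgeConjecture.Cruxes.H413.ThetaNonvanishing`):
* `map_glue_eq_prod_mulSingle` — a multiplicative `w` trivial on the box subgroup of level `T` factorises on every level
  `S ⊇ T`: `w(e⁻¹ glue_S(x,k)) = ∏_{v∈S} w(e⁻¹ ι_v(x_v))` (★ PerL34 `extendOne` ∕ `map_eq_prod_map_mulSingle`);
* `smul_glue_apply_of_mem` ∕ `smul_glue_eq_unitVec_of_not_mem` — the acted family `(E b) • Φ` along a glued point: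
  `ρ_v(E_v x_v) Φ_v` on `S`, `1_{𝒪_vⁿ}` off `S`;
* **`finCoeff_glue_eq_smul_prod`** — the integrand on the level `S ⊇ T` equals
  `μ(𝒪̂ⁿ) • ∏_{v ∈ S} fl_v(x_v)`, `fl_v(g) = (ν_v(𝒪_vⁿ)⁻¹ • ⟨ρ_v(E_v g) Φ_v, Ψ_v⟩_{ν_v}) · w(e⁻¹ ι_v(g))`;
* **`finCoeff_isPureTensor`** — the same in the exact shape of the consumer's binder, the Haar constant `μ(𝒪̂ⁿ)` absorbed
  into the local factor at a chosen place `i₀ ∈ T` (`Function.update`).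

[cite: Li1992, Thm 2.1 (27) p. 184] [cite: TateThesis1967, Thm 3.3.1] [cite: Bump1997, §3.5]
-/

set_option autoImplicit false
set_option linter.dupNamespace false

noncomputable section

open scoped RestrictedProduct ENNReal NNReal ComplexConjugate
open MeasureTheory NumberField IsDedekindDomain Filter Function Set
open Literature.NumberTheory.Automorphic
open HodgeCM.PerL34 HodgeCM.PerL34.RestrictedMeasure HodgeCM.PerL34.PureTensor HodgeCM.PerL34.NoSmallSubgroups

namespace Summit.HodgeConjecture.HodgeConjecture.Cruxes.H413.ThetaNonvanishing

variable (F E : Type) [Field F] [NumberField F] [Field E] [NumberField E] [Algebra F E]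
  (c : E ≃ₐ[F] E) (M : ℕ) (JW : Matrix (Fin M) (Fin M) E)

/-! ## §0 Bookkeeping: absorbing a scalar into one local factor -/

/-- `∏_{v ∈ S} (update fl i₀ (c • fl i₀))_v(x_v) = c • ∏_{v ∈ S} fl_v(x_v)` for `i₀ ∈ S` (plumbing: the Haar constant is
absorbed at one place). [cite: TateThesis1967, Thm 3.3.1] -/
theorem prod_update_smul_apply {ι : Type*} [DecidableEq ι] {β : ι → Type*} (fl : ∀ i, β i → ℂ) (r : ℝ)
    {i₀ : ι} (S : Finset ι) (hi₀ : i₀ ∈ S) (x : ∀ i : ↥S, β i) :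
    ∏ i : ↥S, Function.update fl i₀ (fun g => r • fl i₀ g) i.1 (x i) = r • ∏ i : ↥S, fl i.1 (x i) := by
  have hpt : ∀ i : ↥S, Function.update fl i₀ (fun g => r • fl i₀ g) i.1 (x i) =
      (if i = ⟨i₀, hi₀⟩ then (r : ℂ) else 1) * fl i.1 (x i) := by
    intro i
    by_cases h : i = ⟨i₀, hi₀⟩
    · subst h
      rw [Function.update_self, if_pos rfl, Complex.real_smul]
    · have h' : (i : ι) ≠ i₀ := fun h'' => h (Subtype.ext h'')
      rw [Function.update_of_ne h', if_neg h, one_mul]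
  rw [Finset.prod_congr rfl fun i _ => hpt i, Finset.prod_mul_distrib, Finset.prod_ite_eq', if_pos (Finset.mem_univ _),
    Complex.real_smul]

/-! ## §1 A multiplicative map trivial on a box subgroup factorises along the glued levels -/

section Char

variable [DecidableEq (HeightOneSpectrum (𝓞 F))]

/-- **`w(e⁻¹ glue_S(x, k)) = ∏_{v ∈ S} w(e⁻¹ ι_v(x_v))`** for a multiplicative `w : U(J)(𝔸_{F,f}) →* ℂ` trivial on the box
subgroup `∏_{v∉T} U(J)(𝒪_v) × ∏_{v∈T}{1}` and `S ⊇ T` (the glued point is `extendOne(x) · k'` with `k'` in the box subgroup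
of level `S ≤` level `T`; a homomorphism out of the finite product `∏_{v∈S} U(J)(F_v)` is the product of its restrictions).
[cite: Li1992, Thm 2.1 (27) p. 184] -/
theorem map_glue_eq_prod_mulSingle (w : UnitaryGroup.finAdelic F E c M JW →* ℂ) (T : Finset (HeightOneSpectrum (𝓞 F)))
    (hw : ∀ k ∈ RestrictedProduct.boxSubgroup (fun v => UnitaryGroup.localInt E c M JW v) T,
      w ((UnitaryGroup.finAdelicEquiv F E c M JW).symm k) = 1)
    (S : Finset (HeightOneSpectrum (𝓞 F))) (hTS : T ⊆ S)
    (x : ((v : ↥S) → UnitaryGroup.localPi E c M JW v) ×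
      ((v : {v // v ∉ S}) → (UnitaryGroup.localInt E c M JW v : Set (UnitaryGroup.localPi E c M JW v)))) :
    w ((UnitaryGroup.finAdelicEquiv F E c M JW).symm
        (glue (fun v => (UnitaryGroup.localInt E c M JW v : Set (UnitaryGroup.localPi E c M JW v))) S x)) =
      ∏ v : ↥S, w ((UnitaryGroup.finAdelicEquiv F E c M JW).symm
        (RestrictedProduct.mulSingle (fun v => UnitaryGroup.localInt E c M JW v) v.1 (x.1 v))) := by
  have hS : ∀ (v : HeightOneSpectrum (𝓞 F)) (hv : v ∈ S),
      glue (fun v => (UnitaryGroup.localInt E c M JW v : Set (UnitaryGroup.localPi E c M JW v))) S x v =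
        x.1 ⟨v, hv⟩ := fun v hv =>
    glue_apply_of_mem (fun v => (UnitaryGroup.localInt E c M JW v : Set (UnitaryGroup.localPi E c M JW v))) S x hv
  have hS' : ∀ v, v ∉ S →
      glue (fun v => (UnitaryGroup.localInt E c M JW v : Set (UnitaryGroup.localPi E c M JW v))) S x v ∈
        UnitaryGroup.localInt E c M JW v := fun v hv => by
    rw [glue_apply_of_not_mem
      (fun v => (UnitaryGroup.localInt E c M JW v : Set (UnitaryGroup.localPi E c M JW v))) S x hv]
    exact (x.2 ⟨v, hv⟩).2
  have hk := boxSubgroup_antitone (fun v => UnitaryGroup.localInt E c M JW v) hTS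
    (extendOne_inv_mul_mem_boxSubgroup (fun v => UnitaryGroup.localInt E c M JW v) S x.1 _ hS hS')
  -- `W = w ∘ e⁻¹` as a homomorphism on the restricted product
  let W : (Πʳ v : HeightOneSpectrum (𝓞 F), [UnitaryGroup.localPi E c M JW v, UnitaryGroup.localInt E c M JW v]) →* ℂ :=
    { toFun := fun k => w ((UnitaryGroup.finAdelicEquiv F E c M JW).symm k)
      map_one' := by simp only [map_one]
      map_mul' := fun a b => by simp only [map_mul] }
  have hW : ∀ k, W k = w ((UnitaryGroup.finAdelicEquiv F E c M JW).symm k) := fun _ => rfl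
  calc w ((UnitaryGroup.finAdelicEquiv F E c M JW).symm
          (glue (fun v => (UnitaryGroup.localInt E c M JW v : Set (UnitaryGroup.localPi E c M JW v))) S x))
      = W (extendOne (fun v => UnitaryGroup.localInt E c M JW v) S x.1 *
          ((extendOne (fun v => UnitaryGroup.localInt E c M JW v) S x.1)⁻¹ *
            glue (fun v => (UnitaryGroup.localInt E c M JW v : Set (UnitaryGroup.localPi E c M JW v))) S x)) := by
        rw [mul_inv_cancel_left]; rfl
    _ = W (extendOne (fun v => UnitaryGroup.localInt E c M JW v) S x.1) := by
        rw [map_mul, hW ((extendOne (fun v => UnitaryGroup.localInt E c M JW v) S x.1)⁻¹ * _), hw _ hk, mul_one]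
    _ = ∏ v : ↥S, (W.comp (extendOne (fun v => UnitaryGroup.localInt E c M JW v) S)) (Pi.mulSingle v (x.1 v)) :=
        map_eq_prod_map_mulSingle (W.comp (extendOne (fun v => UnitaryGroup.localInt E c M JW v) S)) x.1
    _ = ∏ v : ↥S, w ((UnitaryGroup.finAdelicEquiv F E c M JW).symm
          (RestrictedProduct.mulSingle (fun v => UnitaryGroup.localInt E c M JW v) v.1 (x.1 v))) :=
        Finset.prod_congr rfl fun v _ => by rw [MonoidHom.comp_apply, extendOne_mulSingle, hW]

end Char

/-! ## §2 The acted family along a glued point -/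

section Smul

variable {n : ℕ} {Gb : HeightOneSpectrum (𝓞 F) → Type} [∀ v, Group (Gb v)] (Kb : ∀ v, Subgroup (Gb v))
  (ρ : ∀ v : HeightOneSpectrum (𝓞 F), Representation ℂ (Gb v) ↥(SchwartzBruhat (Fin n → v.adicCompletion F)))
  (hρ : ∀ᶠ v in cofinite, unitVec F (Fin n) v ∈ (ρ v).fixedPoints (Kb v))
  (Eb : UnitaryGroup.finAdelic F E c M JW → Πʳ v : HeightOneSpectrum (𝓞 F), [Gb v, Kb v])
  (Eloc : ∀ v : HeightOneSpectrum (𝓞 F), UnitaryGroup.localPi E c M JW v → Gb v)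
  (hE : ∀ b v, Eb b v = Eloc v (UnitaryGroup.evalPlace F E c M JW v b))

include hE in
/-- on `S`, the `v`-component of `(E b) • Φ` at the glued point `b = e⁻¹ glue_S(x, k)` is `ρ_v(E_v x_v) Φ_v`.
[cite: Li1992, Thm 2.1 (27) p. 184] -/
theorem smul_glue_apply_of_mem (Φ : LocalSBFamily F (Fin n)) (S : Finset (HeightOneSpectrum (𝓞 F)))
    (x : ((v : ↥S) → UnitaryGroup.localPi E c M JW v) ×
      ((v : {v // v ∉ S}) → (UnitaryGroup.localInt E c M JW v : Set (UnitaryGroup.localPi E c M JW v))))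
    {v : HeightOneSpectrum (𝓞 F)} (hv : v ∈ S) :
    RestrictedFamily.smul ρ hρ (Eb ((UnitaryGroup.finAdelicEquiv F E c M JW).symm
        (glue (fun v => (UnitaryGroup.localInt E c M JW v : Set (UnitaryGroup.localPi E c M JW v))) S x))) Φ v =
      ρ v (Eloc v (x.1 ⟨v, hv⟩)) (Φ v) := by
  have hcomp : UnitaryGroup.evalPlace F E c M JW v ((UnitaryGroup.finAdelicEquiv F E c M JW).symm
      (glue (fun v => (UnitaryGroup.localInt E c M JW v : Set (UnitaryGroup.localPi E c M JW v))) S x)) =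
        x.1 ⟨v, hv⟩ := by
    change (UnitaryGroup.finAdelicEquiv F E c M JW ((UnitaryGroup.finAdelicEquiv F E c M JW).symm _)) v = _
    rw [ContinuousMulEquiv.apply_symm_apply]
    exact glue_apply_of_mem
      (fun v => (UnitaryGroup.localInt E c M JW v : Set (UnitaryGroup.localPi E c M JW v))) S x hv
  rw [RestrictedFamily.smul_apply, hE, hcomp]

include hE in
/-- off `S ⊇ T`, the `v`-component of `(E b) • Φ` at a glued point is the unit vector `1_{𝒪_vⁿ}` (the `v`-component of `b`
lies in `U(J)(𝒪_v)`, `E_v` maps it into `K_v`, which fixes `1_{𝒪_vⁿ}`, and `Φ_v = 1_{𝒪_vⁿ}`).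
[cite: Li1992, Thm 2.1 (27) p. 184] -/
theorem smul_glue_eq_unitVec_of_not_mem (T : Finset (HeightOneSpectrum (𝓞 F)))
    (hEint : ∀ v ∉ T, ∀ k : UnitaryGroup.localPi E c M JW v, k ∈ UnitaryGroup.localInt E c M JW v → Eloc v k ∈ Kb v)
    (hρT : ∀ v ∉ T, unitVec F (Fin n) v ∈ (ρ v).fixedPoints (Kb v))
    (Φ : LocalSBFamily F (Fin n)) (hΦ : ∀ v ∉ T, Φ v = unitVec F (Fin n) v)
    (S : Finset (HeightOneSpectrum (𝓞 F))) (hTS : T ⊆ S)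
    (x : ((v : ↥S) → UnitaryGroup.localPi E c M JW v) ×
      ((v : {v // v ∉ S}) → (UnitaryGroup.localInt E c M JW v : Set (UnitaryGroup.localPi E c M JW v))))
    {v : HeightOneSpectrum (𝓞 F)} (hv : v ∉ S) :
    RestrictedFamily.smul ρ hρ (Eb ((UnitaryGroup.finAdelicEquiv F E c M JW).symm
        (glue (fun v => (UnitaryGroup.localInt E c M JW v : Set (UnitaryGroup.localPi E c M JW v))) S x))) Φ v =
      unitVec F (Fin n) v := by
  have hvT : v ∉ T := fun h => hv (hTS h)
  rw [RestrictedFamily.smul_apply, hE, hΦ v hvT]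
  have hcomp : UnitaryGroup.evalPlace F E c M JW v ((UnitaryGroup.finAdelicEquiv F E c M JW).symm
      (glue (fun v => (UnitaryGroup.localInt E c M JW v : Set (UnitaryGroup.localPi E c M JW v))) S x)) =
        (x.2 ⟨v, hv⟩ : UnitaryGroup.localPi E c M JW v) := by
    change (UnitaryGroup.finAdelicEquiv F E c M JW ((UnitaryGroup.finAdelicEquiv F E c M JW).symm _)) v = _
    rw [ContinuousMulEquiv.apply_symm_apply]
    exact glue_apply_of_not_mem
      (fun v => (UnitaryGroup.localInt E c M JW v : Set (UnitaryGroup.localPi E c M JW v))) S x hv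
  rw [hcomp]
  exact ((ρ v).mem_fixedPoints (Kb v) _).1 (hρT v hvT) _ (hEint v hvT _ (x.2 ⟨v, hv⟩).2)

end Smul

/-! ## §3 The finite Fourier-coefficient integrand of two pure tensors is a pure tensor -/

section Coeff

variable [DecidableEq (HeightOneSpectrum (𝓞 F))]
  {n : ℕ} {Gb : HeightOneSpectrum (𝓞 F) → Type} [∀ v, Group (Gb v)] (Kb : ∀ v, Subgroup (Gb v))
  (ρ : ∀ v : HeightOneSpectrum (𝓞 F), Representation ℂ (Gb v) ↥(SchwartzBruhat (Fin n → v.adicCompletion F)))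
  (hρ : ∀ᶠ v in cofinite, unitVec F (Fin n) v ∈ (ρ v).fixedPoints (Kb v))
  (Eb : UnitaryGroup.finAdelic F E c M JW → Πʳ v : HeightOneSpectrum (𝓞 F), [Gb v, Kb v])
  (Eloc : ∀ v : HeightOneSpectrum (𝓞 F), UnitaryGroup.localPi E c M JW v → Gb v)
  (hE : ∀ b v, Eb b v = Eloc v (UnitaryGroup.evalPlace F E c M JW v b))
  (ωfin : UnitaryGroup.finAdelic F E c M JW → ↥(SchwartzBruhat (Fin n → FiniteAdeleRing (𝓞 F) F)) →
    ↥(SchwartzBruhat (Fin n → FiniteAdeleRing (𝓞 F) F)))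
  (hω : ∀ b (Φ : LocalSBFamily F (Fin n)),
    ωfin b (piProdSB F (Fin n) Φ) = piProdSB F (Fin n) (RestrictedFamily.smul ρ hρ (Eb b) Φ))
  (w : UnitaryGroup.finAdelic F E c M JW →* ℂ) (T : Finset (HeightOneSpectrum (𝓞 F)))
  (hw : ∀ k ∈ RestrictedProduct.boxSubgroup (fun v => UnitaryGroup.localInt E c M JW v) T,
    w ((UnitaryGroup.finAdelicEquiv F E c M JW).symm k) = 1)
  (hEint : ∀ v ∉ T, ∀ k : UnitaryGroup.localPi E c M JW v, k ∈ UnitaryGroup.localInt E c M JW v → Eloc v k ∈ Kb v)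
  (hρT : ∀ v ∉ T, unitVec F (Fin n) v ∈ (ρ v).fixedPoints (Kb v))
  [MeasurableSpace (FiniteAdeleRing (𝓞 F) F)] [BorelSpace (FiniteAdeleRing (𝓞 F) F)]
  [∀ v : HeightOneSpectrum (𝓞 F), MeasurableSpace (v.adicCompletion F)]
  [∀ v : HeightOneSpectrum (𝓞 F), BorelSpace (v.adicCompletion F)]
  (μ : Measure (Fin n → FiniteAdeleRing (𝓞 F) F)) [μ.IsAddHaarMeasure]
  (ν : ∀ v : HeightOneSpectrum (𝓞 F), Measure (Fin n → v.adicCompletion F)) [∀ v, (ν v).IsAddHaarMeasure]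
  (Φ Ψ : LocalSBFamily F (Fin n)) (hΦ : ∀ v ∉ T, Φ v = unitVec F (Fin n) v) (hΨ : ∀ v ∉ T, Ψ v = unitVec F (Fin n) v)

include hE hω hw hEint hρT hΦ hΨ in
/-- **(F2) The finite Fourier-coefficient integrand of a pair of pure tensors is a pure tensor.**  On every level
`S ⊇ T` and every glued point `b = e⁻¹ glue_S(x, k)` (`x ∈ ∏_{v∈S} U(J)(F_v)`, `k ∈ ∏_{v∉S} U(J)(𝒪_v)`),
`(∫ (ω_f(b)(⊗Φ_v))(y) conj((⊗Ψ_v)(y)) dμ) · w(b) = μ(𝒪̂ⁿ) • ∏_{v ∈ S} fl_v(x_v)` with the LOCAL FACTORS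
`fl_v(g) = (ν_v(𝒪_vⁿ)⁻¹ • ∫ (ρ_v(E_v g)Φ_v) conj(Ψ_v) dν_v) · w(e⁻¹ ι_v(g))` ([Li1992, (27)]: `⟨ω(h)Φ, Ψ⟩ χ(h) = ∏_v …` for
`Φ = ⊗Φ_v`). [cite: Li1992, Thm 2.1 (27) p. 184] [cite: TateThesis1967, Thm 3.3.1] [cite: Bump1997, §3.5] -/
theorem finCoeff_glue_eq_smul_prod (S : Finset (HeightOneSpectrum (𝓞 F))) (hTS : T ⊆ S)
    (x : ((v : ↥S) → UnitaryGroup.localPi E c M JW v) ×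
      ((v : {v // v ∉ S}) → (UnitaryGroup.localInt E c M JW v : Set (UnitaryGroup.localPi E c M JW v)))) :
    (∫ y, ((ωfin ((UnitaryGroup.finAdelicEquiv F E c M JW).symm
          (glue (fun v => (UnitaryGroup.localInt E c M JW v : Set (UnitaryGroup.localPi E c M JW v))) S x))
          (piProdSB F (Fin n) Φ) : ↥(SchwartzBruhat (Fin n → FiniteAdeleRing (𝓞 F) F))) :
          (Fin n → FiniteAdeleRing (𝓞 F) F) → ℂ) y *
        conj (((piProdSB F (Fin n) Ψ : ↥(SchwartzBruhat (Fin n → FiniteAdeleRing (𝓞 F) F))) :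
          (Fin n → FiniteAdeleRing (𝓞 F) F) → ℂ) y) ∂μ) *
      w ((UnitaryGroup.finAdelicEquiv F E c M JW).symm
          (glue (fun v => (UnitaryGroup.localInt E c M JW v : Set (UnitaryGroup.localPi E c M JW v))) S x)) =
    (μ (offBox (ι := Fin n) ∅)).toReal • ∏ v : ↥S,
      (((ν v.1 (integralBox F (Fin n) v.1)).toReal⁻¹ •
        ∫ z, ((ρ v.1 (Eloc v.1 (x.1 v)) (Φ v.1) : ↥(SchwartzBruhat (Fin n → v.1.adicCompletion F))) :
            (Fin n → v.1.adicCompletion F) → ℂ) z *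
          conj (((Ψ v.1 : ↥(SchwartzBruhat (Fin n → v.1.adicCompletion F))) :
            (Fin n → v.1.adicCompletion F) → ℂ) z) ∂ν v.1) *
        w ((UnitaryGroup.finAdelicEquiv F E c M JW).symm
          (RestrictedProduct.mulSingle (fun v => UnitaryGroup.localInt E c M JW v) v.1 (x.1 v)))) := by
  set b := (UnitaryGroup.finAdelicEquiv F E c M JW).symm
    (glue (fun v => (UnitaryGroup.localInt E c M JW v : Set (UnitaryGroup.localPi E c M JW v))) S x) with hb
  -- the acted family `Φᵇ = (E b) • Φ` is unramified off `S`
  set Φb : LocalSBFamily F (Fin n) := RestrictedFamily.smul ρ hρ (Eb b) Φ with hΦb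
  have hΦbS : ∀ v ∉ S, Φb v = unitVec F (Fin n) v := fun v hv =>
    smul_glue_eq_unitVec_of_not_mem F E c M JW Kb ρ hρ Eb Eloc hE T hEint hρT Φ hΦ S hTS x hv
  have hΨS : ∀ v ∉ S, Ψ v = unitVec F (Fin n) v := fun v hv => hΨ v fun h => hv (hTS h)
  -- (i) the operator on the pure tensor, (iii) the pairing of pure tensors
  rw [hω b Φ, coe_piProdSB, coe_piProdSB,
    integral_piProd_mul_conj_piProd_eq F (Fin n) μ ν Φb Ψ S hΦbS hΨS,
    -- (ii) the character
    map_glue_eq_prod_mulSingle F E c M JW w T hw S hTS x,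
    ← Finset.prod_coe_sort S, smul_mul_assoc, ← Finset.prod_mul_distrib]
  refine congrArg _ (Finset.prod_congr rfl fun v _ => ?_)
  rw [show Φb v.1 = ρ v.1 (Eloc v.1 (x.1 v)) (Φ v.1) from
    smul_glue_apply_of_mem F E c M JW Kb ρ hρ Eb Eloc hE Φ S x v.2]

include hE hω hw hEint hρT hΦ hΨ in
/-- **(F2) in the consumer's shape** (★ `exists_integral_finAdelic_eq_tprod`): with the Haar constant `μ(𝒪̂ⁿ)` absorbed into
the local factor at a place `i₀ ∈ T`, the integrand `f(b) = ⟨ω_f(b)(⊗Φ_v), ⊗Ψ_v⟩_μ · w(b)` satisfies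
`f(e⁻¹ glue_S(x, k)) = ∏_{v ∈ S} fl_v(x_v)` for all `S ⊇ T`. [cite: Li1992, Thm 2.1 (27) p. 184] [cite: TateThesis1967, Thm 3.3.1] -/
theorem finCoeff_isPureTensor {i₀ : HeightOneSpectrum (𝓞 F)} (hi₀ : i₀ ∈ T)
    (S : Finset (HeightOneSpectrum (𝓞 F))) (hTS : T ⊆ S)
    (x : ((v : ↥S) → UnitaryGroup.localPi E c M JW v) ×
      ((v : {v // v ∉ S}) → (UnitaryGroup.localInt E c M JW v : Set (UnitaryGroup.localPi E c M JW v)))) :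
    (∫ y, ((ωfin ((UnitaryGroup.finAdelicEquiv F E c M JW).symm
          (glue (fun v => (UnitaryGroup.localInt E c M JW v : Set (UnitaryGroup.localPi E c M JW v))) S x))
          (piProdSB F (Fin n) Φ) : ↥(SchwartzBruhat (Fin n → FiniteAdeleRing (𝓞 F) F))) :
          (Fin n → FiniteAdeleRing (𝓞 F) F) → ℂ) y *
        conj (((piProdSB F (Fin n) Ψ : ↥(SchwartzBruhat (Fin n → FiniteAdeleRing (𝓞 F) F))) :
          (Fin n → FiniteAdeleRing (𝓞 F) F) → ℂ) y) ∂μ) *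
      w ((UnitaryGroup.finAdelicEquiv F E c M JW).symm
          (glue (fun v => (UnitaryGroup.localInt E c M JW v : Set (UnitaryGroup.localPi E c M JW v))) S x)) =
    ∏ v : ↥S, Function.update
      (fun (v : HeightOneSpectrum (𝓞 F)) (g : UnitaryGroup.localPi E c M JW v) =>
        (((ν v (integralBox F (Fin n) v)).toReal⁻¹ •
          ∫ z, ((ρ v (Eloc v g) (Φ v) : ↥(SchwartzBruhat (Fin n → v.adicCompletion F))) :
              (Fin n → v.adicCompletion F) → ℂ) z *
            conj (((Ψ v : ↥(SchwartzBruhat (Fin n → v.adicCompletion F))) :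
              (Fin n → v.adicCompletion F) → ℂ) z) ∂ν v) *
          w ((UnitaryGroup.finAdelicEquiv F E c M JW).symm
            (RestrictedProduct.mulSingle (fun v => UnitaryGroup.localInt E c M JW v) v g))))
      i₀ (fun g => (μ (offBox (ι := Fin n) ∅)).toReal •
        (((ν i₀ (integralBox F (Fin n) i₀)).toReal⁻¹ •
          ∫ z, ((ρ i₀ (Eloc i₀ g) (Φ i₀) : ↥(SchwartzBruhat (Fin n → i₀.adicCompletion F))) :
              (Fin n → i₀.adicCompletion F) → ℂ) z *
            conj (((Ψ i₀ : ↥(SchwartzBruhat (Fin n → i₀.adicCompletion F))) :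
              (Fin n → i₀.adicCompletion F) → ℂ) z) ∂ν i₀) *
          w ((UnitaryGroup.finAdelicEquiv F E c M JW).symm
            (RestrictedProduct.mulSingle (fun v => UnitaryGroup.localInt E c M JW v) i₀ g))))
      v.1 (x.1 v) := by
  rw [finCoeff_glue_eq_smul_prod F E c M JW Kb ρ hρ Eb Eloc hE ωfin hω w T hw hEint hρT μ ν Φ Ψ hΦ hΨ S hTS x]
  exact (prod_update_smul_apply (β := fun v => UnitaryGroup.localPi E c M JW v)
    (fun (v : HeightOneSpectrum (𝓞 F)) (g : UnitaryGroup.localPi E c M JW v) =>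
      (((ν v (integralBox F (Fin n) v)).toReal⁻¹ •
        ∫ z, ((ρ v (Eloc v g) (Φ v) : ↥(SchwartzBruhat (Fin n → v.adicCompletion F))) :
            (Fin n → v.adicCompletion F) → ℂ) z *
          conj (((Ψ v : ↥(SchwartzBruhat (Fin n → v.adicCompletion F))) :
            (Fin n → v.adicCompletion F) → ℂ) z) ∂ν v) *
        w ((UnitaryGroup.finAdelicEquiv F E c M JW).symm
          (RestrictedProduct.mulSingle (fun v => UnitaryGroup.localInt E c M JW v) v g))))
    (μ (offBox (ι := Fin n) ∅)).toReal S (hTS hi₀) x.1).symm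

end Coeff

end Summit.HodgeConjecture.HodgeConjecture.Cruxes.H413.ThetaNonvanishing

end
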